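import Summits.HodgeConjecture.HodgeConjecture.Cruxes.H413.Lines.F0_U3LettersRung1KitD
import Summits.HodgeConjecture.HodgeConjecture.Theorems.F0P3cCohClassRoutingCotClosed3   -- ★ (R90-C133-p01 (g2), THREAD-₃ link (4)): `CohClassRoutingCotClosed₃`, `cohClassRoutingCotClosed₃_of_closed`, `cohClassRoutingCot_of_closed₃`, `cohClassRoutingCotClosed₃_of_s2Fin₃`
import HarnessLib

/-!
# KIT D — THREAD-₃ TWIN `Rung0Choice.rows_of₃` (HOME cand of K2E1-typ1 (g3) «S5∕typ1», DEAL (H22) S5 DEALER R90-C133-plan (g3) 2026-09-05T02:38:08Z «LINK (5) KIT ₃ DRAFTS,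
REPORT-FIRST»; census `K2/K2E1-typ1/g3/kit3/CENSUS-L5.md`).  NEW-FILE FORM importing the TREE `F0_U3LettersRung1KitD` ED. 7 (base sha16 6af57a74c79aca04) + the ★ two-place routing
letter; convertible to a pure APPEND inside KitD's `section D2` (ED. 8) by dropping this header and the `section D3` variable block — heir LEAD F0P3a-plan (g22)'s byte call;
the Kit pen of record writes (director (c)).  ADDITIONS ONLY, R-QS1-7 «h3 THREADING»: `Rung0Choice.rows_of` (:271) is kept and never edited.
CONTENT: `Rung0Choice.rows_of₃ (hL3₃ : F0P3cCohClassRoutingCotClosed3.CohClassRoutingCotClosed₃) (hdef) (h2) (h3)` — the FOURTEEN ROWS at the choice's kit, function form over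
the TWO-PLACE closed guarded routing letter: statement = `rows_of`'s (:271–:286) with the ONE extra binder `(h3 : 3 ≤ Module.finrank ℚ ↥(maximalRealSubfield L))`, SAME
conclusion byte-for-byte; proof = `rows_of`'s body (:287–:406) byte-for-byte except the ONE line that reads the routing letter (:391, row #15 `Routing` — the only place
`hL3` is consumed): `exact hL3₃ L ι H T hT (transpose…) (isUnit…) hdef h2 h3 μ μω hμu hμω C.W.μZ (keysOfKeysCaseTwo …)` (binder order of ★ `CohClassRoutingCotClosed₃`).
Consumer (link (6), AGG ED. 47): `Rung0Choice.rows₃ (hdef) (h2) (h3) := C.rows_of₃ stub_L3₃ hdef h2 h3` with `stub_L3₃ := ★ cohClassRoutingCotClosed₃_of_s2Fin₃ stub_S2fin₃`.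
FOLLOW-UP (optional, not additions-only, guard-agnostic): a one-frame function form `Rung0Choice.rows_ofCot (hL3v : CohClassRoutingCot … ι T hT μ)` from which `rows_of`,
`rows_of₃` and any later frame guard are one-liners, at the next edition allowed to touch `rows_of`'s body.
NO `sorry`, NO registered row, no `instance`, no notation.
HONEST LABEL: engineering only — nothing is discharged by a twin; HC_CM is proved only modulo the 7 printed citations (2 remaining named inputs: hLiu418 =
stmt-HodgeConjecture-24832, h413 = stmt-HodgeConjecture-24833) until rung 0 closes.
-/

set_option autoImplicit false
set_option linter.dupNamespace false

noncomputable section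

namespace Summit.HodgeConjecture.HodgeConjecture.Cruxes.H413.F0U3LettersRung1

open MeasureTheory NumberField IsDedekindDomain
open Literature.NumberTheory.Automorphic Literature.NumberTheory.Automorphic.UnitaryGroup
open Literature.NumberTheory.Rogawski1990 Literature.NumberTheory.GaloisRepresentations
open Summit.HodgeConjecture.HodgeConjecture.Cruxes.H413
open Summit.HodgeConjecture.HodgeConjecture.Cruxes.H413.F0T1InnerFormTraceIdentity (ComparisonKit SpecOverride GpAdelic GpLocal HLocal GpInf GInf HInf IsAnisotropic IsHermitianCM)
open Summit.HodgeConjecture.HodgeConjecture.Cruxes.H413.F0P3InnerFormClassificationV6 (Gp Places Cinf EvpData)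
open Summit.HodgeConjecture.HodgeConjecture.Cruxes.H413.F0P3KitOfRecord (kitOfRecord GHSide socketsOfT1 FrameData kitFamilyOfRecord letters_of_specPkgV8
  traceIdentity_kitOfRecord_override)
open Summit.HodgeConjecture.HodgeConjecture.Cruxes.H413.F0P3XiSideOfRecord (xiSideOfRecord xiFamilyFin_kitOfRecord xiUnram_kitOfRecord_of_xiPinSphericalCofinite evpConvention_kitOfRecord)
open Summit.HodgeConjecture.HodgeConjecture.Cruxes.H413.F0P3XiPacketFamilyOfRecord (keysOfKeysCaseTwo hCM_of_cmCharIdentityPackage hexc_of_xiPinSphericalCofinite)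
open Summit.HodgeConjecture.HodgeConjecture.Cruxes.H413.F0P3XiArchPacketOfRecord (JInfNoDegOne DsInfNoDegOne)
open Summit.HodgeConjecture.HodgeConjecture.Cruxes.H413.F0P3UnitaryLocOfRecord (IsCohUnitaryClass)
open Summit.HodgeConjecture.HodgeConjecture.Cruxes.H413.F0P3LettersTraceFactorisation (IsProductHaar)
open scoped Matrix ComplexOrder

section D3

variable {L : Type} [Field L] [NumberField L] [IsCMField L] {ι : L →+* ℂ} {H : Matrix (Fin 3) (Fin 3) L} {T : GL (Fin 3) ℂ}
  {hT : (T : Matrix (Fin 3) (Fin 3) ℂ)ᴴ * H.map ι * (T : Matrix (Fin 3) (Fin 3) ℂ) = Literature.Geometry.ComplexHyperbolic.BallModel.J}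
  {μ : Measure (Gp L H).automorphicQuotient} [(Gp L H).IsAutomorphicMeasure μ] {μω : HeckeCharacter L} {hμu : μω.IsUnitary}
  {hμω : ∀ x : Literature.NumberTheory.GaloisRepresentations.ideleGroup ↥(maximalRealSubfield L),
    μω (AdeleRing.ideleBaseChange (↥(maximalRealSubfield L)) L x) = quadraticHeckeCharCM L x}
  (C : Rung0Choice L ι H T hT μ μω hμu hμω)

set_option synthInstance.maxHeartbeats 400000 in
set_option maxHeartbeats 4000000 in
/-- **THE FOURTEEN ROWS AT THE CHOICE՚S KIT — FUNCTION FORM over the TWO-PLACE closed guarded routing letter `hL3₃ : F0P3cCohClassRoutingCotClosed3.CohClassRoutingCotClosed₃`**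
(R-QS1-7 «h3 THREADING» twin of `Rung0Choice.rows_of` :271: SAME fourteen-row conclusion at ONE level `S₀`; ONE extra binder `h3 : 3 ≤ [L⁺:ℚ]`, read ONLY by row #15 `Routing`
(★ T2 head `routing₈_kitOfRecordSCD_of_cot` fed the one-frame guarded letter `hL3₃ … hdef h2 h3 …`); the thirteen other rows are `rows_of`'s terms byte-for-byte).
The aggregator՚s `Rung0Choice.rows₃ := C.rows_of₃ stub_L3₃ …`. [cite: Rogawski1990, §14.6 Thm. 14.6.1 p. 241, Thm. 14.6.4 p. 244; §15.3 ¶1 p. 249; §12.3 ll. 4–9 p. 174; §13.1 p. 199] [cite: Rogawski1992, Thm. 1.1 p. 396; Thm. 1.2 p. 397] -/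
theorem Rung0Choice.rows_of₃ (hL3₃ : F0P3cCohClassRoutingCotClosed3.CohClassRoutingCotClosed₃)
    (hdef : ∀ τ' : L →+* ℂ, InfinitePlace.mk τ' ≠ InfinitePlace.mk ι → (H.map τ').PosDef) (h2 : 2 ≤ Module.finrank ℚ ↥(maximalRealSubfield L))
    (h3 : 3 ≤ Module.finrank ℚ ↥(maximalRealSubfield L)) :
    ∃ S₀ : Finset (Places L),
      F0P3InnerFormClassificationV8.ClassificationKit.SpecPkg C.kit S₀ ∧
      F0P3InnerFormClassificationV6.ClassificationKit.TraceIdentity C.kit ∧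
      F0P3InnerFormClassificationV8.ClassificationKit.FactorisationCls C.kit S₀ ∧
      F0P3InnerFormClassificationV6.ClassificationKit.SpectralSideGp C.kit ∧
      F0P3InnerFormClassificationV8.ClassificationKit.HatBounded C.kit S₀ ∧
      F0P3InnerFormClassificationV8.ClassificationKit.UnrStarAlgebra C.kit S₀ ∧
      F0P3InnerFormClassificationV6.ClassificationKit.LinIndepS C.kit ∧
      F0P3InnerFormClassificationV8.ClassificationKit.UnitaryPacket C.kit S₀ ∧
      F0P3InnerFormClassificationV8.ClassificationKit.Routing C.kit ∧
      JInfNoDegOne C.W.jInf ∧ DsInfNoDegOne C.W.dsInf ∧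
      F0P3InnerFormClassificationV6.ClassificationKit.XiFamilyFin C.kit μω hμu ∧
      F0P3InnerFormClassificationV6.ClassificationKit.XiUnram C.kit ∧
      F0P3InnerFormClassificationV6.ClassificationKit.EvpConvention C.kit := by
  classical
  letI : MeasurableSpace (GpAdelic L H) := borel _
  haveI : BorelSpace (GpAdelic L H) := ⟨rfl⟩
  haveI : C.W.ν.IsHaarMeasure := C.W.isHaar_ν
  haveI : C.W.ν.IsInvInvariant := C.W.isInvInv_ν
  letI : ∀ v : Places L, MeasurableSpace (GpLocal L H v) := fun _ => borel _
  haveI : ∀ v : Places L, BorelSpace (GpLocal L H v) := fun _ => ⟨rfl⟩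
  letI : ∀ v : Places L, MeasurableSpace (HLocal L v) := fun _ => borel _
  haveI : ∀ v : Places L, BorelSpace (HLocal L v) := fun _ => ⟨rfl⟩
  letI : ∀ (v : Places L) (a : HLocal L v), MeasurableSpace (HLocal L v ⧸ Subgroup.centralizer ({a} : Set (HLocal L v))) := fun _ _ => borel _
  letI : ∀ (v : Places L) (γ : GpLocal L H v), MeasurableSpace (GpLocal L H v ⧸ Subgroup.centralizer ({γ} : Set (GpLocal L H v))) := fun _ _ => borel _
  letI : MeasurableSpace (GpInf L H) := borel _
  haveI : BorelSpace (GpInf L H) := ⟨rfl⟩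
  letI : MeasurableSpace (GInf L) := borel _
  haveI : BorelSpace (GInf L) := ⟨rfl⟩
  letI : MeasurableSpace (HInf L) := borel _
  haveI : BorelSpace (HInf L) := ⟨rfl⟩
  haveI : ∀ v : Places L, (C.W.νH v).IsHaarMeasure := C.W.isHaar_νH
  haveI : ∀ v : Places L, (C.W.νH v).IsMulRightInvariant := C.W.isRightInv_νH
  haveI : ∀ v : Places L, (C.W.νG v).IsHaarMeasure := C.W.isHaar_νG
  haveI : ∀ v : Places L, (C.W.νG v).IsMulRightInvariant := C.W.isRightInv_νG
  haveI : IsFiniteMeasureOnCompacts C.W.νGi := C.W.finCpt_νGi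
  haveI : C.W.νGi.IsMulRightInvariant := C.W.rightInv_νGi
  haveI : IsFiniteMeasureOnCompacts C.W.νqi := C.W.finCpt_νqi
  haveI : C.W.νqi.IsMulRightInvariant := C.W.rightInv_νqi
  haveI : IsFiniteMeasureOnCompacts C.W.νHi := C.W.finCpt_νHi
  haveI : C.W.νHi.IsMulRightInvariant := C.W.rightInv_νHi
  -- the `Gp`-spelled copies of the adelic instances, keyed on `borel (GpAdelic L H)` (the σ-algebra the field `W.ν` carries), so that every ★ glue lemma
  -- typed over `(Gp L H).Adelic` finds `BorelSpace` ∕ finiteness after unifying its measure binder with `W.ν` (`cmDatum` vs `adelicGroupData` is not reducible)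
  letI : MeasurableSpace (Gp L H).Adelic := borel (GpAdelic L H)
  haveI : BorelSpace (Gp L H).Adelic := ⟨rfl⟩
  haveI : IsFiniteMeasureOnCompacts (show @Measure (Gp L H).Adelic (borel (GpAdelic L H)) from C.W.ν) :=
    (show @Measure.IsHaarMeasure (Gp L H).Adelic _ _ (borel _) C.W.ν from C.W.isHaar_ν).toIsFiniteMeasureOnCompacts
  haveI : (show @Measure (Gp L H).Adelic (borel (GpAdelic L H)) from C.W.ν).IsHaarMeasure := C.W.isHaar_ν
  letI : MeasurableSpace (Gp L H).Adelic := borel ((Gp L H).Adelic)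
  haveI : BorelSpace (Gp L H).Adelic := ⟨rfl⟩
  haveI : IsFiniteMeasureOnCompacts (show @Measure (Gp L H).Adelic (borel ((Gp L H).Adelic)) from C.W.ν) :=
    (show @Measure.IsHaarMeasure (Gp L H).Adelic _ _ (borel _) C.W.ν from C.W.isHaar_ν).toIsFiniteMeasureOnCompacts
  haveI : (show @Measure (Gp L H).Adelic (borel ((Gp L H).Adelic)) from C.W.ν).IsHaarMeasure := C.W.isHaar_ν
  letI : ∀ v : Places L, MeasurableSpace (Gqs L v ⧸ Subgroup.center (Gqs L v)) := fun _ => borel _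
  haveI : ∀ v : Places L, BorelSpace (Gqs L v ⧸ Subgroup.center (Gqs L v)) := fun _ => ⟨rfl⟩
  haveI : ∀ v : Places L, (C.W.μZ v).IsHaarMeasure := C.W.isHaar_μZ
  have hanis : IsAnisotropic L H := F0P3ClassTokensOfRecord.anisotropic_of_frame L H ι hdef h2
  have hherm : IsHermitianCM L H := transpose_map_cmConjRingHom_eq_of_frame L ι H T hT
  dsimp only [Rung0Choice.kit, kitK9S]
  -- TF: the class factorisation at some level `S₀ᵀᶠ` (★ letter glue + PH)
  obtain ⟨STF, hTF⟩ := F0P3LettersTraceFactorisationS0.traceFactorisation_kitOfRecord L H ι T hT μ (socketsOfT1 L H μ (C.𝔨.override C.OW.ov)) C.OW.gh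
    (F0P3XiSideOfRecordSCD.xiSideOfRecordSCD L H (transpose_map_cmConjRingHom_eq_of_frame L ι H T hT) (isUnit_det_of_frame L ι H T hT) μω hμu C.W.μZ (keysOfKeysCaseTwo L μω (stub_Keys L) C.W.μZ (fun v _ => isQuadraticCharExtension_semilocalComponent_of_baseChange_eq μω hμω v))
       (F0P3XiPacketFamilyOfRecordSCD.hSCD_of_cmCharIdentityPackageTestSigned L H (transpose_map_cmConjRingHom_eq_of_frame L ι H T hT) (isUnit_det_of_frame L ι H T hT) μω hμu
        C.𝔨.Δ C.𝔨.mH C.mG₀ C.W.νG C.W.νH C.W.μZ C.hQ)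
       (fun ξ => hexc_of_xiPinSphericalCofinite L μω hμu C.W.μZ (keysOfKeysCaseTwo L μω (stub_Keys L) C.W.μZ (fun v _ => isQuadraticCharExtension_semilocalComponent_of_baseChange_eq μω hμω v)) (fun v _ => isQuadraticCharExtension_semilocalComponent_of_baseChange_eq μω hμω v) (stub_79 L) ξ)
       C.W.νG C.OW.evpG C.OW.evpH C.OW.ramG C.OW.ramH C.OW.PiXi C.OW.ρXi)
    μω C.W.c C.W.jInf C.W.dsInf C.W.ν C.W.νGi C.W.νG C.W.hPH (stub_TF L H ι T hT hdef h2 μ C.W.ν C.W.νGi C.W.νG)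
  refine ⟨C.OW.S₀ ∪ STF, C.OW.specPkg.mono _ Finset.subset_union_left, ?_, ?_, ?_, ?_, ?_, ?_, ?_, ?_, C.W.hJ, C.W.hD, ?_, ?_, ?_⟩
  · -- #1 `TraceIdentity` = T1's head at the overridden kit; law T1b from the NON-REGULAR residual `stub_T1b` via ★ `IsPinned.ellipticStabilisation_of_lawT1bNonreg` (ED. 5, (V56)(iv))
    rw [F0P3KitOfRecordW.traceIdentity_kitOfRecordW_iff]   -- ED. 3: #1 `TraceIdentity` (v6) is sign-BLIND — transport the W-kit goal to `kitOfRecord … c …` (★1b, `Iff.rfl`) and reuse the ED. 2 ★ term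
    exact traceIdentity_kitOfRecord_override L H ι T hT μ C.𝔨 C.OW.ov C.OW.gh _ μω C.W.c C.W.jInf C.W.dsInf _ C.W.ν C.W.νG _ C.hSTF
      (ComparisonKit.IsPinned.ellipticStabilisation_of_lawT1bNonreg (h := C.hpin) (hanis := hanis) (hherm := hherm)
        (hνG := C.W.isHaar_νG) (hK := C.W.hK) (hνH := C.W.isHaar_νH) (hKH := C.W.hKH) (ha := C.hSTF)
        (hnon := stub_T1b L H hherm hanis μ C.W.ν C.W.νH C.W.νG C.W.νGi C.W.νqi C.W.νHi C.W.Tinf C.𝔨 C.hpin))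
      C.htE C.OW.specPkgT1
  · -- TF, class conjunct, lifted to `S₀`
    rw [F0P3KitOfRecordW.factorisationCls₈_kitOfRecordW_iff]   -- ED. 3: TF `FactorisationCls S₀` (v8) is sign-BLIND — transport the W-kit goal to `kitOfRecord … c …` (★1b, `Iff.rfl`) and reuse the ED. 2 ★ term
    exact fun S c fS fT hS => hTF S (Finset.subset_union_right.trans hS) c fS fT
  · -- #2 `SpectralSideGp` from «SSG» + pin (v)
    rw [F0P3KitOfRecordW.spectralSideGp_kitOfRecordW_iff]   -- ED. 3: #2 `SpectralSideGp` (v6) is sign-BLIND — transport the W-kit goal to `kitOfRecord … c …` (★1b, `Iff.rfl`) and reuse the ED. 2 ★ term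
    refine F0P3LettersSpectralSideGp.spectralSideGp_kitOfRecord L H ι T hT μ (socketsOfT1 L H μ (C.𝔨.override C.OW.ov)) C.OW.gh _ μω C.W.c C.W.jInf
      C.W.dsInf _ C.W.ν C.W.νG _ hanis (stub_SSG L H μ C.W.ν hanis) ?_
    intro F
    rw [show (socketsOfT1 L H μ (C.𝔨.override C.OW.ov)).traceGp = C.𝔨.traceGp from rfl,
      ComparisonKit.IsPinned.traceGp_eq (h := C.hpin) (hanis := hanis)]
  · -- #6 `HatBounded S₀` at BOTH summands, IN-HOUSE from the pins + the packet ANCHORS (ED. 6; ★ B-p12 `hatBounded_kitOfRecord_of_anchored`)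
    refine F0P3InnerFormClassificationV8.ClassificationKit.HatBounded.mono Finset.subset_union_left ?_
    rw [F0P3KitOfRecordW.hatBounded₈_kitOfRecordW_iff]   -- ED. 3: #6 `HatBounded S₀` (v8) is sign-BLIND — transport the W-kit goal to `kitOfRecord … c …` (★1b, `Iff.rfl`) and reuse the ED. 2 ★ term
    apply F0P3HatLawsKitK9.hatBounded_kitOfRecord_of_anchored
    · exact hdef
    · exact h2
    · exact C.W.isHaar_νG
    · exact C.OW.anchorG
    · exact C.OW.anchorH
  · -- #7 `UnrStarAlgebra S₀` at BOTH summands, IN-HOUSE (ED. 6; ★ B-p12 `unrStarAlgebra_kitOfRecord_of_anchored`)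
    refine F0P3InnerFormClassificationV8.ClassificationKit.UnrStarAlgebra.mono Finset.subset_union_left ?_
    rw [F0P3KitOfRecordW.unrStarAlgebra₈_kitOfRecordW_iff]   -- ED. 3: #7 `UnrStarAlgebra S₀` (v8) is sign-BLIND — transport the W-kit goal to `kitOfRecord … c …` (★1b, `Iff.rfl`) and reuse the ED. 2 ★ term
    apply F0P3HatLawsKitK9.unrStarAlgebra_kitOfRecord_of_anchored
    · exact hdef
    · exact h2
    · exact C.W.isHaar_νG
    · exact C.OW.anchorG
    · exact C.OW.anchorH
  · -- #8 `LinIndepS` from (L2-SA)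
    rw [F0P3KitOfRecordW.linIndepS_kitOfRecordW_iff]   -- ED. 3: #8 `LinIndepS` (v6) is sign-BLIND — transport the W-kit goal to `kitOfRecord … c …` (★1b, `Iff.rfl`) and reuse the ED. 2 ★ term
    exact F0P3LettersLinIndepS.linIndepS_kitOfRecord L H ι T hT μ (socketsOfT1 L H μ (C.𝔨.override C.OW.ov)) C.OW.gh _ μω C.W.c C.W.jInf C.W.dsInf
      C.W.νGi C.W.ν C.W.νG _ (stub_L2SA L ι H T hT C.W.νGi C.W.νG) hdef C.W.hPH.isHaarMeasure_arch C.W.isHaar_νG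
  · -- #10 `UnitaryPacket S₀` from XLPU + the coh-unitarity of the arch classes (v6 text AT THE W KIT via ★1b, then the v8 guard)
    refine F0P3InnerFormClassificationV8.ClassificationKit.unitaryPacket_of_v6 _ ?_ _
    apply F0P3KitOfRecordW.unitaryPacket_kitOfRecordW_of   -- ED. 3: ★7 «UP-W» (★1b p847021) — row #10 reads `expansion ≠ 0`, sign-BEARING, so it is re-proved AT THE W KIT (same three inputs)
    · apply F0P3XiSideOfRecordSCD.hFinU_xiSideOfRecordSCD
      exact stub_XLPU L H (transpose_map_cmConjRingHom_eq_of_frame L ι H T hT) (isUnit_det_of_frame L ι H T hT) μω hμu hμω C.W.μZ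
        (keysOfKeysCaseTwo L μω (stub_Keys L) C.W.μZ (fun v _ => isQuadraticCharExtension_semilocalComponent_of_baseChange_eq μω hμω v))
    · exact C.W.hJU
    · exact C.W.hDU
  · -- #15 `Routing`, GUARDED v8 text, from the TWO-PLACE closed guarded letter (L3′)-cot₃ ★ `CohClassRoutingCotClosed₃` read at THIS frame (`hdef h2 h3`) = the T2 head BY NAME
    rw [F0P3KitOfRecordW.routing₈_kitOfRecordW_iff]   -- ED. 3: #15 `Routing` (v8) is sign-BLIND — transport the W-kit goal to `kitOfRecord … c …` (★1b, `Iff.rfl`) and reuse the ED. 2 ★ term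
    apply F0T2RoutingKitOfRecordOfCotSCD.routing₈_kitOfRecordSCD_of_cot
    exact hL3₃ L ι H T hT (transpose_map_cmConjRingHom_eq_of_frame L ι H T hT) (isUnit_det_of_frame L ι H T hT) hdef h2 h3 μ μω hμu hμω C.W.μZ
      (keysOfKeysCaseTwo L μω (stub_Keys L) C.W.μZ (fun v _ => isQuadraticCharExtension_semilocalComponent_of_baseChange_eq μω hμω v))
  · -- #20 `XiFamilyFin`
    rw [F0P3KitOfRecordW.xiFamilyFin_kitOfRecordW_iff]   -- ED. 3: #20 `XiFamilyFin` (v6) is sign-BLIND — transport the W-kit goal to `kitOfRecord … c …` (★1b, `Iff.rfl`) and reuse the ED. 2 ★ term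
    apply F0P3XiSideOfRecordSCD.xiFamilyFin_kitOfRecordSCD
  · -- #21 `XiUnram` from #79 + `hquad`
    rw [F0P3KitOfRecordW.xiUnram_kitOfRecordW_iff]   -- ED. 3: #21 `XiUnram` (v6) is sign-BLIND — transport the W-kit goal to `kitOfRecord … c …` (★1b, `Iff.rfl`) and reuse the ED. 2 ★ term
    apply F0P3XiSideOfRecordSCD.xiUnram_kitOfRecordSCD_of_xiPinSphericalCofinite
    · exact (fun v _ => isQuadraticCharExtension_semilocalComponent_of_baseChange_eq μω hμω v)
    · exact stub_79 L
    · exact C.W.isHaar_νG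
  · -- #23 `EvpConvention` from the override's junk conventions
    rw [F0P3KitOfRecordW.evpConvention_kitOfRecordW_iff]   -- ED. 3: #23 `EvpConvention` (v6) is sign-BLIND — transport the W-kit goal to `kitOfRecord … c …` (★1b, `Iff.rfl`) and reuse the ED. 2 ★ term
    apply F0P3XiSideOfRecordSCD.evpConvention_kitOfRecordSCD
    · exact C.OW.hG
    · exact C.OW.hH'

end D3

end Summit.HodgeConjecture.HodgeConjecture.Cruxes.H413.F0U3LettersRung1

end
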